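import Literature.AlgebraicGeometry.RelativeSpec.FreeQuotient
import Mathlib.AlgebraicGeometry.Pullbacks
import HarnessLib

/-!
# Quotients by free finite group actions: `X ×_{X/G} X` is reduced

Continuation of `Literature.AlgebraicGeometry.RelativeSpec.FreeQuotient`. For a free action of a
finite group `G` on `X` over `Y` (`ρ : ActionOver r G`, `r` affine) with quotient
`π : X ⟶ X/G`, the kernel pair `X ×_{X/G} X` is reduced when `X` is: over the chart
`Spec Γ(X, r⁻¹U)^G` of `X/G` it is `Spec (B ⊗_A B)` with `B = Γ(X, r⁻¹U)`, `A = B^G`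
(`exists_iso_pullback_toQuotient`, Mathlib `Scheme.Pullback.openCoverOfBase`, `pullbackSpecIso`),
and `B ⊗_A B ≅ ∏_G B` by Chase–Harrison–Rosenberg (`canonicalEquiv`). This is the (reducedness
content of the) torsor statement `X ×_{X/G} X ≅ G × X` (Mumford, *Abelian Varieties*, §7, Thm.
p. 66; SGA 3, Exp. V, Thm. 4.1), in the form used to descend the group law to the quotient of an
abelian variety by a finite subgroup.

## References

* [MumfordAV1970] D. Mumford, *Abelian Varieties* (1970), §7, Thm. p. 66; §12.
* SGA 3, Exp. V, Thm. 4.1.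
-/

noncomputable section

universe u

open CategoryTheory Limits AlgebraicGeometry
open scoped TensorProduct

namespace Literature.AlgebraicGeometry.RelativeSpec

namespace ActionOver

variable {X Y : Scheme.{u}} {r : X ⟶ Y} {G : Type*} [Group G] (ρ : ActionOver r G)
variable [Finite G] [IsAffineHom r]

set_option backward.defeqAttrib.useBackward true in
set_option backward.isDefEq.respectTransparency false in
/-- **The chart of `π : X ⟶ X/G` over `Spec Γ(X, r⁻¹U)^G`**: the preimage `π⁻¹(chart U)` is
`Spec Γ(X, r⁻¹U)`, and on it `π` is `Spec` of the inclusion of the invariants (cf. the proof of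
`SubringDatum.toSpec_of_forall_specMap`; Mathlib `IsIso toNormalization` pattern). [folklore] -/
theorem exists_iso_pullback_toQuotient (U : Y.affineOpens) :
    ∃ e : pullback ρ.toQuotient (ρ.invariants.openCover.f U) ≅
        Spec Γ(X, r ⁻¹ᵁ U.1),
      e.inv ≫ pullback.snd ρ.toQuotient (ρ.invariants.openCover.f U) =
        Spec.map (CommRingCat.ofHom (ρ.invariantsRing U.1).subtype) := by
  let D := ρ.invariants
  let e := IsOpenImmersion.isoOfRangeEq (pullback.fst D.toSpec (D.openCover.f U))
    (r ⁻¹ᵁ U.1).ι (by simp [← Scheme.Hom.coe_opensRange, Scheme.Hom.opensRange_pullbackFst,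
      ← D.fromSpec_preimage, ← Scheme.Hom.comp_preimage])
  refine ⟨e ≪≫ (U.2.preimage r).isoSpec, ?_⟩
  rw [← cancel_mono (D.openCover.f U), ← cancel_epi (U.2.preimage r).isoSpec.hom]
  simp only [e, Iso.trans_inv, Category.assoc, Iso.hom_inv_id_assoc]
  rw [← pullback.condition, IsOpenImmersion.isoOfRangeEq_inv_fac_assoc,
    IsAffineOpen.isoSpec_hom]
  exact D.ι_lift r D.inclusion U

/-- **For a free action, `X ×_{X/G} X` is reduced when `X` is**: over the chart
`Spec Γ(X, r⁻¹U)^G` it is `Spec (B ⊗_A B)`, `B = Γ(X, r⁻¹U)`, `A = B^G`, and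
`B ⊗_A B ≅ ∏_G B` (Chase–Harrison–Rosenberg, `canonicalEquiv`) is reduced.
(`X ×_{X/G} X ≅ G × X`, Mumford, *Abelian Varieties*, §7, Thm. p. 66; SGA 3, V.4.1.)
[cite: MumfordAV1970, §7 Thm. p. 66] -/
theorem isReduced_pullback_toQuotient [IsReduced X]
    (hfree : ∀ (U : Y.affineOpens) (g : G), g ≠ 1 →
      Ideal.span (Set.range fun b : Γ(X, r ⁻¹ᵁ U) ↦ ρ.act g U b - b) = ⊤) :
    IsReduced (pullback ρ.toQuotient ρ.toQuotient) := by
  let 𝒰 := Scheme.Pullback.openCoverOfBase ρ.invariants.openCover ρ.toQuotient ρ.toQuotient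
  have hX : ∀ U, IsReduced (𝒰.X U) := by
    intro U
    change IsReduced (pullback (pullback.snd ρ.toQuotient (ρ.invariants.openCover.f U))
      (pullback.snd ρ.toQuotient (ρ.invariants.openCover.f U)))
    obtain ⟨e, he⟩ := ρ.exists_iso_pullback_toQuotient U
    -- the algebra `B = Γ(X, r⁻¹U)` over its invariants `A`
    letI := ρ.mulSemiringAction U.1
    let _ : Fintype G := Fintype.ofFinite G
    haveI := ρ.isInvariant_invariantsRing U.1
    haveI := ρ.faithfulSMul_invariantsRing U.1
    let A := ρ.invariantsRing U.1
    -- `B ⊗_A B ≅ ∏_G B` is reduced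
    haveI : _root_.IsReduced (Γ(X, r ⁻¹ᵁ U.1) ⊗[A] Γ(X, r ⁻¹ᵁ U.1)) :=
      isReduced_of_injective
        (Literature.RingTheory.GaloisAlgebras.canonicalEquiv A G (hfree U))
        (Literature.RingTheory.GaloisAlgebras.canonicalEquiv A G (hfree U)).injective
    -- `pullback (snd) (snd) ≅ pullback (Spec ι) (Spec ι) ≅ Spec (B ⊗_A B)`
    have hsnd : pullback.snd ρ.toQuotient (ρ.invariants.openCover.f U) =
        e.hom ≫ Spec.map (CommRingCat.ofHom A.subtype) := by
      rw [← he]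
      exact (e.hom_inv_id_assoc _).symm
    haveI : IsReduced (pullback (Spec.map (CommRingCat.ofHom A.subtype))
        (Spec.map (CommRingCat.ofHom A.subtype))) :=
      isReduced_of_isOpenImmersion (pullbackSpecIso A Γ(X, r ⁻¹ᵁ U.1) Γ(X, r ⁻¹ᵁ U.1)).hom
    let m := pullback.map (e.hom ≫ Spec.map (CommRingCat.ofHom A.subtype))
      (e.hom ≫ Spec.map (CommRingCat.ofHom A.subtype))
      (Spec.map (CommRingCat.ofHom A.subtype)) (Spec.map (CommRingCat.ofHom A.subtype))
      e.hom e.hom (𝟙 _) (by rw [Category.comp_id]) (by rw [Category.comp_id])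
    have hred : IsReduced (pullback (e.hom ≫ Spec.map (CommRingCat.ofHom A.subtype))
        (e.hom ≫ Spec.map (CommRingCat.ofHom A.subtype))) := isReduced_of_isOpenImmersion m
    exact @isReduced_of_isOpenImmersion _ _ (pullback.congrHom hsnd hsnd).hom inferInstance hred
  haveI := hX
  exact IsReduced.of_openCover _ 𝒰

end ActionOver

end Literature.AlgebraicGeometry.RelativeSpec
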